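import Mathlib
import HarnessLib
import Literature.Analysis.FluidPDE.SpaceTimeRescaling
import Literature.Analysis.FluidPDE.DirectionDissipation
import Summits.NavierStokesRegularity.NavierStokesRegularity.Theorems.ChiralWindowDoorDefs

/-!
# Door S20 «ChiralWindowDoor» — the K1 zoom COMMUTES with the chirality defect `curl − Λ`
# (nsreg-p1 `r19/ZoomCommutes.lean`, landed)

Door S20 of nsreg-p1's local Type-I door family (`HOME/ns-regularity-ideate-p1/r19/ROUND-19-DRAFT.md`, `R19-LINE.md`
§PROVED-2; DESIGN-ONLY, route NOT born).  `Λ = (−Δ)^{1/2}` in second-difference kernel form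
(`…Theorems.ChiralWindowDoorDefs.fracLapHalf`) is 1-homogeneous exactly like `curl`:
`Λ((c·u)∘Φ)(s,·)(y) = (cγ) (Λ u(t))(x)` at `(t,x) = Φ(s,y) = (t₀+βs, x₀+γy)`, `γ > 0`, with NO integrability or
differentiability hypothesis (the Haar change of variables `Measure.integral_comp_smul` holds for junk values too).
Together with the tree's `curl_smul_stPull` this makes the K1 window functional of the chiral door,
`‖(T−t)•(curl − Λ)(u t)(x₀+√(T−t)y)‖`, LITERALLY the chirality defect of the zoomed slice (`c = γ = √(T−t)`, `β = γ²`)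
— the «non-locality of `Λ` vs the zoom» hazard of R19-LINE §B is answered by a kernel-checked identity.

* `fracLapHalf_smul_stPull` — **`Λ` commutes with the parabolic zoom**;
* `chiralDefect_smul_stPull` — the chirality defect of the zoomed slice is the rescaled chirality defect.

Texts and proofs: nsreg-p1 g16 (`r19/ZoomCommutes.lean` sha16 975d75f599033459), landed here with credit over the tree
substrate (`lamK_eq_smul` is the substrate's).  Seat nsreg-p6 g11 (THEOREMS-ONLY door sequels, DIRECTOR-NS g8 #32 (2)/#36).
WHAT THIS IS NOT: not NS regularity (Clay A); not K1 `LocalPointZoomChiralWindow` (the zoom's compactness and the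
passage of the non-local functional to the limit remain); no route is opened.
-/

noncomputable section

-- the summit and its single sub-problem share the name (CONVENTIONS §1), as in every Theorems file
set_option linter.dupNamespace false

namespace Summit.NavierStokesRegularity.NavierStokesRegularity.Theorems.ChiralWindowDoorZoomCommutes

open MeasureTheory
open Literature.Analysis Literature.Analysis.FluidPDE
open Summit.NavierStokesRegularity.NavierStokesRegularity.Theorems.ChiralWindowDoorDefs

/-- **`Λ` commutes with the parabolic zoom** (1-homogeneity). -/
theorem fracLapHalf_smul_stPull (c β γ t₀ : ℝ) (hγ : 0 < γ) (x₀ : EuclideanSpace ℝ (Fin 3)) (u : ℝ → EuclideanSpace ℝ (Fin 3) → EuclideanSpace ℝ (Fin 3)) (s : ℝ) (y : EuclideanSpace ℝ (Fin 3)) :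
    fracLapHalf ((c • stPull β γ t₀ x₀ u) s) y = (c * γ) • fracLapHalf (u (t₀ + β * s)) (x₀ + γ • y) := by
  set X : EuclideanSpace ℝ (Fin 3) := x₀ + γ • y with hX
  set U : EuclideanSpace ℝ (Fin 3) → EuclideanSpace ℝ (Fin 3) := u (t₀ + β * s) with hU
  set F : EuclideanSpace ℝ (Fin 3) → EuclideanSpace ℝ (Fin 3) := fun w => lamK w • ((2 : ℝ) • U X - U (X + w) - U (X - w)) with hF
  have hint : ∀ z : EuclideanSpace ℝ (Fin 3), lamK z • ((2 : ℝ) • (c • stPull β γ t₀ x₀ u) s y - (c • stPull β γ t₀ x₀ u) s (y + z) -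
      (c • stPull β γ t₀ x₀ u) s (y - z)) = (c * γ ^ 4) • F (γ • z) := by
    intro z
    have e1 : (c • stPull β γ t₀ x₀ u) s y = c • U X := rfl
    have e2 : (c • stPull β γ t₀ x₀ u) s (y + z) = c • U (X + γ • z) := by
      show c • u (t₀ + β * s) (x₀ + γ • (y + z)) = c • U (X + γ • z)
      rw [smul_add, ← add_assoc]
    have e3 : (c • stPull β γ t₀ x₀ u) s (y - z) = c • U (X - γ • z) := by
      show c • u (t₀ + β * s) (x₀ + γ • (y - z)) = c • U (X - γ • z)
      rw [smul_sub, ← add_sub_assoc]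
    rw [e1, e2, e3, hF, lamK_eq_smul γ hγ z]
    simp only [smul_sub, smul_smul]
    congr 1 <;> [congr 1; skip] <;> ring_nf
  unfold fracLapHalf
  rw [show (fun z : EuclideanSpace ℝ (Fin 3) => lamK z • ((2 : ℝ) • (c • stPull β γ t₀ x₀ u) s y - (c • stPull β γ t₀ x₀ u) s (y + z) -
      (c • stPull β γ t₀ x₀ u) s (y - z))) = fun z => (c * γ ^ 4) • F (γ • z) from funext hint]
  rw [integral_smul, Measure.integral_comp_smul volume F γ]
  have hfin : Module.finrank ℝ (EuclideanSpace ℝ (Fin 3)) = 3 := finrank_euclideanSpace_fin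
  rw [hfin, abs_of_pos (by positivity : (0 : ℝ) < (γ ^ 3)⁻¹)]
  have hFint : ∫ x, F x = ∫ z, lamK z • ((2 : ℝ) • U X - U (X + z) - U (X - z)) := rfl
  rw [hFint, smul_smul, smul_smul, smul_smul]
  congr 1
  field_simp

/-- **The chirality defect of the zoomed slice is the rescaled chirality defect**:
`(curl − Λ)((c·u)∘Φ)(s,·)(y) = (cγ) • (curl − Λ)(u(t))(x)` — with `c = γ = √(T−t)`, `β = γ²` this is the K1 integrand. -/
theorem chiralDefect_smul_stPull (c β γ t₀ : ℝ) (hγ : 0 < γ) (x₀ : EuclideanSpace ℝ (Fin 3)) (u : ℝ → EuclideanSpace ℝ (Fin 3) → EuclideanSpace ℝ (Fin 3)) (s : ℝ) (y : EuclideanSpace ℝ (Fin 3)) :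
    curl ((c • stPull β γ t₀ x₀ u) s) y - fracLapHalf ((c • stPull β γ t₀ x₀ u) s) y =
      (c * γ) • (curl (u (t₀ + β * s)) (x₀ + γ • y) - fracLapHalf (u (t₀ + β * s)) (x₀ + γ • y)) := by
  rw [curl_smul_stPull, fracLapHalf_smul_stPull c β γ t₀ hγ, smul_sub]

end Summit.NavierStokesRegularity.NavierStokesRegularity.Theorems.ChiralWindowDoorZoomCommutes
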